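import Literature.MathematicalPhysics.QuantumFieldTheory.Balaban1983to89.B2Ineq2116TreeDecayRegion
import Literature.MathematicalPhysics.QuantumFieldTheory.Balaban1983to89.B3Ineq213TreeLength

/-!
# `Balaban1983to89.B1Ineq358TreeLength` — T. Bałaban, *(Higgs)₂,₃ quantum fields in a finite volume. I. A lower bound*,
Commun. Math. Phys. **85** (1982) 603–626 [Balaban1982Higgs1], Prop. 3.2 p. 622 [PDF 20]: the length `d(x₁,…,y_m)` in the kernel
bound (3.58) — *"where d(x₁,…,y_m) denotes a length of the shortest graph connecting the points x₁,…,y_m"* — (and its twin in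
part III [Balaban1983Higgs3] (1.33) p. 420: *"d({□(v)}_{v∈G}) denotes a length of a shortest tree graph connecting the vertices v
localized in □(v)"*) DOMINATES EVERY PAIRWISE DISTANCE, HENCE THE DIAMETER — PROVED: for every symmetric, non-negative edge
length obeying the triangle inequality and vanishing on the diagonal, every connecting edge set has total length `≥ ρ(u, w)` for all
`u, w` (a simple path inside it), so p19's tree length `B3Ineq213.treeLen ρ` is `≥ ρ(u, w)`; on the (Higgs)₂,₃ tori, `d(z) ≥ diam z`.
Consequently the PRINTED kernel hypotheses `|v| ≦ O(1)(Lᵏε)^{κ₀}e^{−δ₀d(z)}` of (3.58)/(1.33) imply the diameter hypotheses under which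
p14's `B1Ineq358TreeDecaySum.abs_poly357_le` (the p. 625 sentence, `O(1)·|T₁^{(k)}|`) and the typer's
`B2Ineq2116TreeDecayRegion.abs_poly357_loc_le(_scale)` ((2.57)/(2.116), `O(1)·|Λ₇|`) were proved — their HONEST-SCOPE sentence *"only the
consequence d ≧ diam is used, so the hypothesis is implied by the print"* becomes a kernel fact (`abs_poly357_le_of_treeLen`,
`abs_poly357_loc_le_of_treeLen`)

statement-level skeleton of published theorems with citation tags; proofs where landed; nothing here is a claim about the Yang–Mills mass gap

PDF held: `paper:balaban1982-cmp85-higgs23-i` (journal page = PDF page + 602), p. 622 (Prop. 3.2) as quoted in p14's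
`B1Prop32InteractionBound`; part III `paper:balaban1983-higgs-2-3-quantum-fields-finite-volume` p. 420 as quoted in p19's
`B3Ineq213TreeLength`.

CITATION HEADER (lean-in-tree rule).  Cell `lit-balaban` (HOME `run/shared/lean/pub/lit-balaban/`), unit `lit-balaban-typer` gen 17
(literature-prover-lit-balaban-typer-g17-0; TAKING line HOME/STATUS.md 2026-08-22T05:57Z).  SKELETON rows served (cells only, no head change):
**B1.Prop3.2** ((3.58)), **B3.Prop1** ((1.33)), **B2.Eq2.116** / **B2.Prop2.1** (the summations of the typer's files 1–2).  USED BY NAME, never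
restated: p19's `B3Ineq213.Connects`, `B3Ineq213.treeLen`, `B3Ineq213.mem_connSets`, `B3Ineq213.treeLen_nonneg` (their file proves the UPPER
bounds `treeLen_le_of_connects`/`treeLen_le_sum_lines`; the lower bound here is new), p14's `B1Ineq358TreeDecaySum.{diam, poly357, polyConst,
abs_poly357_le}`, the typer's `B2Ineq2116TreeDecayRegion.{diam_le_of_forall, polyConstLoc, abs_poly357_loc_le, abs_poly357_loc_le_scale}`,
r14's `B1Ineq234LevelZero.tdist_comm`/`tdist_triangle_real`, `B1Ineq234Concrete.tdist_self` (distance (1.3)); Mathlib's simple-graph paths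
(`SimpleGraph.fromRel`, `Reachable.elim_path`, `Walk.IsPath`, `List.sum_toFinset`).

THE ARGUMENT.  Let `S` connect the vertex set and `T = Σ_{(a,b)∈S} ρ(a,b)`.  In the simple graph whose edges are the pairs of `S` (either
orientation) `u` and `w` are reachable, so joined by a PATH (no repeated vertex, hence no repeated edge); along any walk `ρ(start, end) ≦ Σ` of
the edge lengths (triangle inequality, `ρ(a,a) = 0`); the path's edges are distinct unordered pairs each coming from an element of `S`, so their
total is `≦ T` (lengths `≧ 0`).  Minimising over `S`: `ρ(u,w) ≦ treeLen ρ`.  For a point tuple `z` on `T^{(k)}` with `ρ(i,j) = |z_i − z_j|` ((1.3)):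
every pairwise distance, hence `diam z`, is `≦ d(z)`, so `e^{−δd(z)} ≦ e^{−δ·diam z}` (`δ ≧ 0`).

WHAT THIS FILE PROVES (kernel-checked, zero `sorry`; axioms standard; theorems only).
* §1 **`le_sum_of_connects`** (`ρ u w ≦ Σ_{e∈S} ρ e` for every connecting `S`), **`le_treeLen`** (`ρ u w ≦ treeLen ρ`).
* §2 (edge lengths `ρ_z(i,j) = |z_i − z_j|`, the distance (1.3) in lattice units) `tdist_le_treeLen`, **`diam_le_treeLen`** (`(diam z : ℝ) ≦ treeLen ρ_z`),
  `exp_neg_treeLen_le_exp_neg_diam`.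
* §3 the printed hypotheses feed the landed summations: **`abs_poly357_le_of_treeLen`** (p14's p. 625 bound `A₀·|T^{(k)}|·polyConst` from
  `|c(q;z;κ)| ≦ A₀e^{−δ₀·d(z)}` AS PRINTED) and **`abs_poly357_loc_le_of_treeLen`** / **`abs_poly357_loc_le_scale_of_treeLen`** (the typer's region
  bounds from the printed tree-length decay).
* §4 (v1.1) the Steiner reading: `le_treeLen` at vertex type `Fin q ⊕ W`.
* §5 (v1.2) the converse comparison **`treeLen_le_pred_mul_diam`** (`d(z) ≦ (q − 1)·diam z`, star bound `treeLen_le_star`) and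
  **`kernelBound_treeLen_of_diam`**: the diameter form with rate `δ(q − 1)` implies the printed tree-length form with rate `δ` — the two
  decay hypotheses are equivalent up to constants on terms with boundedly many legs.
* §6 (v1.3) III p. 421 *"… if we sum over localizations"*: `sum_exp_neg_treeLen_le_treeConst` / `sum_exp_neg_treeLen_pin_le` /
  **`sum_exp_neg_treeLen_loc_le`** — the landed diameter summations (p14's whole torus, the typer's pinned / localized) hold with the printed `d(z)`.
HONEST SCOPE.  (a) *"the shortest graph connecting the points"* is read, as in p19's `B3Ineq213TreeLength`, as the minimum over CONNECTING EDGE SETS on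
the points themselves of the total edge length in the distance (1.3) (lattice units of `T^{(k)}`) — no Steiner points (a Steiner tree can only be
shorter by a dimensional factor, which the print's unnamed `δ₀` absorbs; this file's inequality `diam ≦ d` holds for the Steiner reading too — v1.1 §4
formalises exactly that: **`tdist_le_treeLen_steiner`** / **`diam_le_treeLen_steiner`** / `exp_neg_steiner_le_exp_neg_diam` for the tree length of the
extended tuple `(z, w)` on `Fin q ⊕ W`, auxiliary vertices `w` arbitrary).  (b) Nothing about the kernels themselves; Prop. 3.2 / Prop. 1 remain
paper III's.  Nothing here is summit progress.
-/

open scoped BigOperators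

namespace Literature.MathematicalPhysics.QuantumFieldTheory.Balaban1983to89.B1Ineq358TreeLength

open Literature.MathematicalPhysics.QuantumFieldTheory.Balaban1983to89.B3Ineq213 (Connects treeLen mem_connSets treeLen_nonneg)
open Literature.MathematicalPhysics.QuantumFieldTheory.Balaban1983to89.B1Ineq358TreeDecaySum (diam poly357 polyConst abs_poly357_le)
open Literature.MathematicalPhysics.QuantumFieldTheory.Balaban1983to89.B2Ineq2116TreeDecayRegion
  (diam_le_of_forall polyConstLoc abs_poly357_loc_le abs_poly357_loc_le_scale)
open Literature.MathematicalPhysics.QuantumFieldTheory.Balaban1983to89.B1Ineq234LevelZero (tdist_comm tdist_triangle_real)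
open Literature.MathematicalPhysics.QuantumFieldTheory.Balaban1983to89.B1Ineq234Concrete (tdist_self)

/-! ## §1 A connecting edge set is at least as long as any pairwise distance -/

section Generic

variable {V : Type*}

/-- **The length of a connecting graph dominates every pairwise distance**: for an edge length `ρ ≧ 0` with `ρ(a,a) = 0`, `ρ(a,b) = ρ(b,a)`
and the triangle inequality, and every edge set `S` connecting the vertex set (p19's `B3Ineq213.Connects`),
`ρ(u, w) ≦ Σ_{(a,b)∈S} ρ(a, b)` — a simple path from `u` to `w` inside `S` has length `≧ ρ(u,w)` and uses distinct edges of `S`.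
[cite: Balaban1982Higgs1, Prop. 3.2 (3.58) p.622] -/
theorem le_sum_of_connects (ρ : V → V → ℝ) (h0 : ∀ a, ρ a a = 0) (hsymm : ∀ a b, ρ a b = ρ b a)
    (htri : ∀ a b c, ρ a c ≤ ρ a b + ρ b c) (hnn : ∀ a b, 0 ≤ ρ a b)
    {S : Finset (V × V)} (hS : Connects S) (u w : V) :
    ρ u w ≤ ∑ e ∈ S, ρ e.1 e.2 := by
  classical
  -- the simple graph whose edges are the pairs of `S`, either orientation
  let G : SimpleGraph V := SimpleGraph.fromRel fun a b => (a, b) ∈ S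
  -- the symmetric edge length on unordered pairs
  let ρs : Sym2 V → ℝ := Sym2.lift ⟨ρ, hsymm⟩
  have hρs_nonneg : ∀ e : Sym2 V, 0 ≤ ρs e := fun e => Sym2.ind (fun a b => hnn a b) e
  -- (1) along any walk, `ρ(start, end) ≤` the sum of the edge lengths
  have hwalk : ∀ {a b : V} (p : G.Walk a b), ρ a b ≤ (p.edges.map ρs).sum := by
    intro a b p
    induction p with
    | nil => simp [h0]
    | @cons a v b hadj q ih =>
      rw [SimpleGraph.Walk.edges_cons, List.map_cons, List.sum_cons]
      have h1 : ρs s(a, v) = ρ a v := rfl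
      calc ρ a b ≤ ρ a v + ρ v b := htri a v b
        _ ≤ ρs s(a, v) + (q.edges.map ρs).sum := by rw [h1]; exact add_le_add le_rfl ih
  -- (2) `u` and `w` are reachable (the connecting chains of `S` are walks of `G`, a loop `(a,a) ∈ S` being skipped)
  have hreach : G.Reachable u w := by
    have huw := hS u w
    induction huw with
    | rel a b hab =>
      by_cases hne : a = b
      · subst hne
        exact SimpleGraph.Reachable.refl _
      · exact SimpleGraph.Adj.reachable ((SimpleGraph.fromRel_adj _ _ _).2 ⟨hne, Or.inl hab⟩)
    | refl a => exact SimpleGraph.Reachable.refl _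
    | symm a b _ ih => exact ih.symm
    | trans a b c _ _ ih1 ih2 => exact ih1.trans ih2
  -- (3) a path: distinct edges, each an element of `S` up to orientation
  obtain ⟨p, hp⟩ : ∃ p : G.Walk u w, p.IsPath := hreach.elim_path fun p => ⟨p.1, p.2⟩
  have hnodup : p.edges.Nodup := hp.isTrail.edges_nodup
  have hsub : p.edges.toFinset ⊆ S.image (fun e : V × V => s(e.1, e.2)) := by
    intro e he
    rw [List.mem_toFinset] at he
    have hE : e ∈ G.edgeSet := p.edges_subset_edgeSet he
    revert hE
    refine Sym2.ind (fun a b => ?_) e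
    intro hE
    rw [SimpleGraph.mem_edgeSet, SimpleGraph.fromRel_adj] at hE
    rcases hE.2 with hab | hba
    · exact Finset.mem_image.2 ⟨(a, b), hab, rfl⟩
    · exact Finset.mem_image.2 ⟨(b, a), hba, Sym2.eq_swap⟩
  calc ρ u w ≤ (p.edges.map ρs).sum := hwalk p
    _ = ∑ e ∈ p.edges.toFinset, ρs e := (List.sum_toFinset ρs hnodup).symm
    _ ≤ ∑ e ∈ S.image (fun e : V × V => s(e.1, e.2)), ρs e :=
        Finset.sum_le_sum_of_subset_of_nonneg hsub fun e _ _ => hρs_nonneg e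
    _ ≤ ∑ e ∈ S, ρs s(e.1, e.2) := Finset.sum_image_le_of_nonneg fun e _ => hρs_nonneg _
    _ = ∑ e ∈ S, ρ e.1 e.2 := rfl

/-- **The tree length dominates every pairwise distance**: `ρ(u, w) ≦ treeLen ρ` (p19's `B3Ineq213.treeLen`: the minimum over the connecting
edge sets of the total edge length — *"a length of the shortest graph connecting the points"*).
[cite: Balaban1982Higgs1, Prop. 3.2 (3.58) p.622] -/
theorem le_treeLen [Fintype V] (ρ : V → V → ℝ) (h0 : ∀ a, ρ a a = 0) (hsymm : ∀ a b, ρ a b = ρ b a)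
    (htri : ∀ a b c, ρ a c ≤ ρ a b + ρ b c) (hnn : ∀ a b, 0 ≤ ρ a b) (u w : V) :
    ρ u w ≤ treeLen ρ :=
  Finset.le_inf' _ _ fun _ hS => le_sum_of_connects ρ h0 hsymm htri hnn (mem_connSets.1 hS) u w

end Generic

/-! ## §2 Point tuples on the torus `T^{(k)}`: `diam z ≦ d(z)` -/

section Torus

variable {P : HiggsLattice.Params} {k : ℕ}

/-- Every pairwise distance of the tuple is at most the length `d(z)` of the shortest connecting graph.
[cite: Balaban1982Higgs1, Prop. 3.2 (3.58) p.622] -/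
theorem tdist_le_treeLen {q : ℕ} (z : Fin q → HiggsLattice.Site P k) (i j : Fin q) :
    (HiggsLattice.Site.tdist (z i) (z j) : ℝ) ≤ treeLen (fun i j => (HiggsLattice.Site.tdist (z i) (z j) : ℝ)) :=
  le_treeLen (fun i j => (HiggsLattice.Site.tdist (z i) (z j) : ℝ)) (fun a => by simp [tdist_self]) (fun a b => by simp [tdist_comm (z a) (z b)])
    (fun a b c => tdist_triangle_real (z a) (z b) (z c)) (fun a b => Nat.cast_nonneg _) i j

/-- **`diam z ≦ d(z)`**: the diameter of a point tuple (p14's `B1Ineq358TreeDecaySum.diam`) is at most the length of the shortest graph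
connecting its points — the inequality behind the sentence *"the diameter replaces the printed length d ≧ diam"* of the landed summation files.
[cite: Balaban1982Higgs1, Prop. 3.2 (3.58) p.622] -/
theorem diam_le_treeLen {q : ℕ} (z : Fin q → HiggsLattice.Site P k) : (diam z : ℝ) ≤ treeLen (fun i j => (HiggsLattice.Site.tdist (z i) (z j) : ℝ)) := by
  have hT : 0 ≤ treeLen (fun i j => (HiggsLattice.Site.tdist (z i) (z j) : ℝ)) := treeLen_nonneg fun a b => Nat.cast_nonneg _
  have hfloor : diam z ≤ ⌊treeLen (fun i j => (HiggsLattice.Site.tdist (z i) (z j) : ℝ))⌋₊ :=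
    diam_le_of_forall z fun i j => Nat.le_floor (tdist_le_treeLen z i j)
  calc (diam z : ℝ) ≤ (⌊treeLen (fun i j => (HiggsLattice.Site.tdist (z i) (z j) : ℝ))⌋₊ : ℝ) := by exact_mod_cast hfloor
    _ ≤ treeLen (fun i j => (HiggsLattice.Site.tdist (z i) (z j) : ℝ)) := Nat.floor_le hT

/-- Hence the printed decay factor is the smaller one: `e^{−δ·d(z)} ≦ e^{−δ·diam z}` for `δ ≧ 0`. [cite: Balaban1982Higgs1, Prop. 3.2 (3.58) p.622] -/
theorem exp_neg_treeLen_le_exp_neg_diam {q : ℕ} {δ : ℝ} (hδ : 0 ≤ δ) (z : Fin q → HiggsLattice.Site P k) :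
    Real.exp (-(δ * treeLen (fun i j => (HiggsLattice.Site.tdist (z i) (z j) : ℝ)))) ≤ Real.exp (-(δ * (diam z : ℝ))) :=
  Real.exp_le_exp.2 (neg_le_neg (mul_le_mul_of_nonneg_left (diam_le_treeLen z) hδ))

end Torus

/-! ## §3 The printed kernel bounds (3.58)/(1.33) feed the landed summations -/

section Printed

variable {P : HiggsLattice.Params} {k : ℕ} {Lbl : Type} [Fintype Lbl]

omit [Fintype Lbl] in
/-- The printed tree-length decay of the kernels implies the diameter decay used by the landed summation files (`A₀ ≧ 0`, `δ₀ ≧ 0`).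
[cite: Balaban1982Higgs1, Prop. 3.2 (3.58) p.622] -/
theorem kernelBound_diam_of_treeLen {q : ℕ} (coef : (q : ℕ) → (Fin q → HiggsLattice.Site P k) → (Fin q → Lbl) → ℝ)
    {A₀ δ₀ : ℝ} (hA₀ : 0 ≤ A₀) (hδ₀ : 0 ≤ δ₀)
    (h : ∀ (z : Fin q → HiggsLattice.Site P k) (κ : Fin q → Lbl), |coef q z κ| ≤ A₀ * Real.exp (-(δ₀ * treeLen (fun i j => (HiggsLattice.Site.tdist (z i) (z j) : ℝ)))))
    (z : Fin q → HiggsLattice.Site P k) (κ : Fin q → Lbl) :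
    |coef q z κ| ≤ A₀ * Real.exp (-(δ₀ * (diam z : ℝ))) :=
  (h z κ).trans (mul_le_mul_of_nonneg_left (exp_neg_treeLen_le_exp_neg_diam hδ₀ z) hA₀)

/-- **p14's p. 625 bound under the PRINTED hypothesis (3.58)**: kernels `|c(q;z;κ)| ≦ A₀e^{−δ₀·d(z)}` with `d` the length of the shortest graph
connecting the points, fields `|leg| ≦ q₀` ⇒ `|V| ≦ A₀·|T^{(k)}|·polyConst(qmax, |Lbl|, q₀, d, δ₀)` (`B1Ineq358TreeDecaySum.abs_poly357_le` by name).
[cite: Balaban1982Higgs1, p.625 (after (3.66)); Prop. 3.2 (3.57)–(3.58) p.622] -/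
theorem abs_poly357_le_of_treeLen (qmax : ℕ) (coef : (q : ℕ) → (Fin q → HiggsLattice.Site P k) → (Fin q → Lbl) → ℝ)
    (leg : Lbl → HiggsLattice.Site P k → ℝ) {A₀ δ₀ q₀ : ℝ} (hA₀ : 0 ≤ A₀) (hδ₀ : 0 < δ₀) (hq₀ : 0 ≤ q₀)
    (hcoef : ∀ q, q ≤ qmax → ∀ (z : Fin q → HiggsLattice.Site P k) (κ : Fin q → Lbl),
      |coef q z κ| ≤ A₀ * Real.exp (-(δ₀ * treeLen (fun i j => (HiggsLattice.Site.tdist (z i) (z j) : ℝ)))))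
    (hleg : ∀ l x, |leg l x| ≤ q₀) :
    |poly357 qmax coef leg| ≤ A₀ * (Fintype.card (HiggsLattice.Site P k) : ℝ) * polyConst qmax (Fintype.card Lbl) q₀ P.d δ₀ :=
  abs_poly357_le qmax coef leg hA₀ hδ₀ hq₀ (fun q hq => kernelBound_diam_of_treeLen coef hA₀ hδ₀.le (hcoef q hq)) hleg

/-- **The typer's region bound under the PRINTED tree-length decay**: kernels `|c(q;z;κ)| ≦ A₀e^{−δ₀·d(z)}` vanishing unless a point lies in `Λ`,
fields `|leg| ≦ q₀` ⇒ `|V| ≦ A₀·|Λ|·polyConstLoc(qmax, |Lbl|, q₀, d, δ₀)` (`B2Ineq2116TreeDecayRegion.abs_poly357_loc_le` by name).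
[cite: Balaban1982Higgs2, (2.116) p.582; Prop. 2.1 (2.57) p.570] -/
theorem abs_poly357_loc_le_of_treeLen (qmax : ℕ) (coef : (q : ℕ) → (Fin q → HiggsLattice.Site P k) → (Fin q → Lbl) → ℝ)
    (leg : Lbl → HiggsLattice.Site P k → ℝ) (Λ : Finset (HiggsLattice.Site P k))
    {A₀ δ₀ q₀ : ℝ} (hA₀ : 0 ≤ A₀) (hδ₀ : 0 < δ₀) (hq₀ : 0 ≤ q₀)
    (hcoef : ∀ q, q ≤ qmax → ∀ (z : Fin q → HiggsLattice.Site P k) (κ : Fin q → Lbl),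
      |coef q z κ| ≤ A₀ * Real.exp (-(δ₀ * treeLen (fun i j => (HiggsLattice.Site.tdist (z i) (z j) : ℝ)))))
    (hloc : ∀ q, q ≤ qmax → ∀ (z : Fin q → HiggsLattice.Site P k) (κ : Fin q → Lbl), (∀ i, z i ∉ Λ) → coef q z κ = 0)
    (hleg : ∀ l x, |leg l x| ≤ q₀) :
    |poly357 qmax coef leg| ≤ A₀ * (Λ.card : ℝ) * polyConstLoc qmax (Fintype.card Lbl) q₀ P.d δ₀ :=
  abs_poly357_loc_le qmax coef leg Λ hA₀ hδ₀ hq₀ (fun q hq => kernelBound_diam_of_treeLen coef hA₀ hδ₀.le (hcoef q hq)) hloc hleg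

/-- The same in the printed currency `O((Lᵏε)^{κ₀})·|Λ|`: kernels `|c(q;z;κ)| ≦ C₀·s^{κ₀}·e^{−δ₀·d(z)}` AS PRINTED in (I.3.58) ⇒
`|V| ≦ (C₀·polyConstLoc)·s^{κ₀}·|Λ|` (`B2Ineq2116TreeDecayRegion.abs_poly357_loc_le_scale` by name).
[cite: Balaban1982Higgs2, (2.116) p.582; Prop. 2.1 (2.57) p.570] -/
theorem abs_poly357_loc_le_scale_of_treeLen (qmax : ℕ) (coef : (q : ℕ) → (Fin q → HiggsLattice.Site P k) → (Fin q → Lbl) → ℝ)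
    (leg : Lbl → HiggsLattice.Site P k → ℝ) (Λ : Finset (HiggsLattice.Site P k))
    {C₀ s κ₀ δ₀ q₀ : ℝ} (hC₀ : 0 ≤ C₀) (hs : 0 ≤ s) (hδ₀ : 0 < δ₀) (hq₀ : 0 ≤ q₀)
    (hcoef : ∀ q, q ≤ qmax → ∀ (z : Fin q → HiggsLattice.Site P k) (κ : Fin q → Lbl),
      |coef q z κ| ≤ C₀ * s ^ κ₀ * Real.exp (-(δ₀ * treeLen (fun i j => (HiggsLattice.Site.tdist (z i) (z j) : ℝ)))))
    (hloc : ∀ q, q ≤ qmax → ∀ (z : Fin q → HiggsLattice.Site P k) (κ : Fin q → Lbl), (∀ i, z i ∉ Λ) → coef q z κ = 0)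
    (hleg : ∀ l x, |leg l x| ≤ q₀) :
    |poly357 qmax coef leg| ≤ (C₀ * polyConstLoc qmax (Fintype.card Lbl) q₀ P.d δ₀) * s ^ κ₀ * (Λ.card : ℝ) :=
  abs_poly357_loc_le_scale qmax coef leg Λ hC₀ hs hδ₀ hq₀
    (fun q hq => kernelBound_diam_of_treeLen coef (mul_nonneg hC₀ (Real.rpow_nonneg hs κ₀)) hδ₀.le (hcoef q hq)) hloc hleg

end Printed

/-! ## §4 (v1.1, append-only) The Steiner reading: auxiliary vertices do not help below the diameter -/

section Steiner

variable {P : HiggsLattice.Params} {k : ℕ}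

/-- **Steiner points allowed.**  HONEST SCOPE (a) of v1 closed: if the *"shortest graph connecting the points"* may pass through AUXILIARY
lattice points `w : W → T^{(k)}` (a Steiner tree), its length — p19's `treeLen` of the COMBINED tuple `(z, w)` on `Fin q ⊕ W` — still dominates
every pairwise distance of the original points (`le_treeLen` holds for every finite vertex type). [cite: Balaban1982Higgs1, Prop. 3.2 (3.58) p.622] -/
theorem tdist_le_treeLen_steiner {q : ℕ} (z : Fin q → HiggsLattice.Site P k) {W : Type*} [Fintype W]
    (w : W → HiggsLattice.Site P k) (i j : Fin q) :
    (HiggsLattice.Site.tdist (z i) (z j) : ℝ)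
      ≤ treeLen (fun a b : Fin q ⊕ W => (HiggsLattice.Site.tdist (Sum.elim z w a) (Sum.elim z w b) : ℝ)) :=
  le_treeLen (fun a b : Fin q ⊕ W => (HiggsLattice.Site.tdist (Sum.elim z w a) (Sum.elim z w b) : ℝ))
    (fun a => by simp [tdist_self]) (fun a b => by simp [tdist_comm (Sum.elim z w a) (Sum.elim z w b)])
    (fun a b c => tdist_triangle_real _ _ _) (fun a b => Nat.cast_nonneg _) (Sum.inl i) (Sum.inl j)

/-- Hence `diam z ≦` the length of every Steiner tree through the points `z` (auxiliary vertices `w` arbitrary).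
[cite: Balaban1982Higgs1, Prop. 3.2 (3.58) p.622] -/
theorem diam_le_treeLen_steiner {q : ℕ} (z : Fin q → HiggsLattice.Site P k) {W : Type*} [Fintype W]
    (w : W → HiggsLattice.Site P k) :
    (diam z : ℝ) ≤ treeLen (fun a b : Fin q ⊕ W => (HiggsLattice.Site.tdist (Sum.elim z w a) (Sum.elim z w b) : ℝ)) := by
  have hT : 0 ≤ treeLen (fun a b : Fin q ⊕ W => (HiggsLattice.Site.tdist (Sum.elim z w a) (Sum.elim z w b) : ℝ)) :=
    treeLen_nonneg fun a b => Nat.cast_nonneg _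
  have hfloor : diam z ≤ ⌊treeLen (fun a b : Fin q ⊕ W => (HiggsLattice.Site.tdist (Sum.elim z w a) (Sum.elim z w b) : ℝ))⌋₊ :=
    diam_le_of_forall z fun i j => Nat.le_floor (tdist_le_treeLen_steiner z w i j)
  calc (diam z : ℝ) ≤ (⌊treeLen (fun a b : Fin q ⊕ W => (HiggsLattice.Site.tdist (Sum.elim z w a) (Sum.elim z w b) : ℝ))⌋₊ : ℝ) := by
        exact_mod_cast hfloor
    _ ≤ _ := Nat.floor_le hT

/-- And the Steiner-tree decay factor is again the smaller one: `e^{−δ·d_Steiner(z)} ≦ e^{−δ·diam z}` (`δ ≧ 0`), so kernel bounds with a Steiner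
length also feed the landed summations through `kernelBound_diam_of_treeLen`-type monotonicity. [cite: Balaban1982Higgs1, Prop. 3.2 (3.58) p.622] -/
theorem exp_neg_steiner_le_exp_neg_diam {q : ℕ} {δ : ℝ} (hδ : 0 ≤ δ) (z : Fin q → HiggsLattice.Site P k) {W : Type*} [Fintype W]
    (w : W → HiggsLattice.Site P k) :
    Real.exp (-(δ * treeLen (fun a b : Fin q ⊕ W => (HiggsLattice.Site.tdist (Sum.elim z w a) (Sum.elim z w b) : ℝ))))
      ≤ Real.exp (-(δ * (diam z : ℝ))) :=
  Real.exp_le_exp.2 (neg_le_neg (mul_le_mul_of_nonneg_left (diam_le_treeLen_steiner z w) hδ))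

end Steiner

/-! ## §5 (v1.2, append-only) The converse comparison `d(z) ≦ (q − 1)·diam z`: the two decay forms are equivalent up to constants -/

section Converse

variable {V : Type*} [Fintype V] [DecidableEq V]

/-- **Star bound.**  The tree length is at most the length of the star at any vertex `i₀`: `treeLen ρ ≦ Σ_j ρ(i₀, j)` (the star
`{(i₀, j)}_j` connects; p19's `treeLen_le_of_connects`). [cite: Balaban1982Higgs1, Prop. 3.2 (3.58) p.622] -/
theorem treeLen_le_star (ρ : V → V → ℝ) (i₀ : V) : treeLen ρ ≤ ∑ j, ρ i₀ j := by
  classical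
  set S : Finset (V × V) := Finset.univ.image fun j : V => (i₀, j) with hSdef
  have hmem : ∀ j, (i₀, j) ∈ S := fun j => Finset.mem_image.2 ⟨j, Finset.mem_univ _, rfl⟩
  have hS : Connects S := fun u w =>
    Relation.EqvGen.trans u i₀ w (Relation.EqvGen.symm i₀ u (Relation.EqvGen.rel i₀ u (hmem u)))
      (Relation.EqvGen.rel i₀ w (hmem w))
  calc treeLen ρ ≤ ∑ e ∈ S, ρ e.1 e.2 := B3Ineq213.treeLen_le_of_connects ρ hS
    _ = ∑ j, ρ i₀ j := by
        rw [hSdef, Finset.sum_image fun a _ b _ h => (Prod.mk.inj h).2]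

/-- Hence, for an edge length bounded by `D` with `ρ(i₀, i₀) = 0`: `treeLen ρ ≦ (|V| − 1)·D`.
[cite: Balaban1982Higgs1, Prop. 3.2 (3.58) p.622] -/
theorem treeLen_le_card_sub_one_mul (ρ : V → V → ℝ) (i₀ : V) (h0 : ρ i₀ i₀ = 0) {D : ℝ} (hD : ∀ j, ρ i₀ j ≤ D) :
    treeLen ρ ≤ ((Fintype.card V - 1 : ℕ) : ℝ) * D := by
  classical
  refine (treeLen_le_star ρ i₀).trans ?_
  have hsplit : ∑ j, ρ i₀ j = ∑ j ∈ Finset.univ.erase i₀, ρ i₀ j := by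
    rw [← Finset.add_sum_erase Finset.univ (fun j => ρ i₀ j) (Finset.mem_univ i₀), h0, zero_add]
  rw [hsplit]
  calc ∑ j ∈ Finset.univ.erase i₀, ρ i₀ j ≤ ∑ j ∈ Finset.univ.erase i₀, D := Finset.sum_le_sum fun j _ => hD j
    _ = ((Fintype.card V - 1 : ℕ) : ℝ) * D := by
        rw [Finset.sum_const, nsmul_eq_mul, Finset.card_erase_of_mem (Finset.mem_univ i₀), Finset.card_univ]

end Converse

section ConverseTorus

variable {P : HiggsLattice.Params} {k : ℕ}

/-- **`d(z) ≦ (q − 1)·diam z`** on the tori: the printed tree length of a `q`-tuple is at most `q − 1` diameters (a star through any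
point; for `q = 0` both sides vanish).  With `diam_le_treeLen`: `diam z ≦ d(z) ≦ (q − 1)·diam z` — the tree-length decay of (3.58) and
the diameter decay DISPLAYED in p14's `B1Ineq358TreeDecaySum` are the same hypothesis up to `δ₀ ↦ δ₀/(q̄ − 1)` on terms with `≦ q̄` legs.
[cite: Balaban1982Higgs1, Prop. 3.2 (3.58) p.622] -/
theorem treeLen_le_pred_mul_diam {q : ℕ} (z : Fin q → HiggsLattice.Site P k) :
    treeLen (fun i j => (HiggsLattice.Site.tdist (z i) (z j) : ℝ)) ≤ ((q - 1 : ℕ) : ℝ) * (diam z : ℝ) := by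
  rcases Nat.eq_zero_or_pos q with hq | hq
  · subst hq
    have hS : Connects (∅ : Finset (Fin 0 × Fin 0)) := fun u => Fin.elim0 u
    simpa using B3Ineq213.treeLen_le_of_connects (fun i j => (HiggsLattice.Site.tdist (z i) (z j) : ℝ)) hS
  · have h := treeLen_le_card_sub_one_mul (fun i j => (HiggsLattice.Site.tdist (z i) (z j) : ℝ)) ⟨0, hq⟩
      (by simp [tdist_self]) (D := (diam z : ℝ)) fun j => by exact_mod_cast B1Ineq358TreeDecaySum.tdist_le_diam z ⟨0, hq⟩ j
    simpa [Fintype.card_fin] using h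

/-- The converse decay comparison: `e^{−(δ(q−1))·diam z} ≦ e^{−δ·d(z)}` for `δ ≧ 0` — a kernel bound in p14's DIAMETER form with rate
`δ₀(q̄ − 1)` implies the PRINTED tree-length form (3.58) with rate `δ₀` (companion of `exp_neg_treeLen_le_exp_neg_diam`).
[cite: Balaban1982Higgs1, Prop. 3.2 (3.58) p.622] -/
theorem exp_neg_pred_mul_diam_le_exp_neg_treeLen {q : ℕ} {δ : ℝ} (hδ : 0 ≤ δ) (z : Fin q → HiggsLattice.Site P k) :
    Real.exp (-(δ * ((q - 1 : ℕ) : ℝ) * (diam z : ℝ)))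
      ≤ Real.exp (-(δ * treeLen (fun i j => (HiggsLattice.Site.tdist (z i) (z j) : ℝ)))) := by
  refine Real.exp_le_exp.2 (neg_le_neg ?_)
  rw [mul_assoc]
  exact mul_le_mul_of_nonneg_left (treeLen_le_pred_mul_diam z) hδ

/-- **The printed hypothesis from the displayed one.**  A kernel bound in diameter form with the enlarged rate,
`|c(q;z;κ)| ≦ A·e^{−δ(q−1)·diam z}`, implies the tree-length form `|c(q;z;κ)| ≦ A·e^{−δ·d(z)}` AS PRINTED in (3.58) (`A ≧ 0`, `δ ≧ 0`).
[cite: Balaban1982Higgs1, Prop. 3.2 (3.58) p.622] -/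
theorem kernelBound_treeLen_of_diam {Lbl : Type*} {q : ℕ} (coef : (q : ℕ) → (Fin q → HiggsLattice.Site P k) → (Fin q → Lbl) → ℝ)
    {A δ : ℝ} (hA : 0 ≤ A) (hδ : 0 ≤ δ)
    (hcoef : ∀ z κ, |coef q z κ| ≤ A * Real.exp (-(δ * ((q - 1 : ℕ) : ℝ) * (diam z : ℝ)))) (z : Fin q → HiggsLattice.Site P k)
    (κ : Fin q → Lbl) :
    |coef q z κ| ≤ A * Real.exp (-(δ * treeLen (fun i j => (HiggsLattice.Site.tdist (z i) (z j) : ℝ)))) :=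
  (hcoef z κ).trans (mul_le_mul_of_nonneg_left (exp_neg_pred_mul_diam_le_exp_neg_treeLen hδ z) hA)

end ConverseTorus

/-! ## §6 (v1.3, append-only) *"… if we sum over localizations"* (III p. 421): the tree-length decay is summable over localization tuples -/

section LocalizationSums

variable {P : HiggsLattice.Params} {k : ℕ}

open Literature.MathematicalPhysics.QuantumFieldTheory.Balaban1983to89.B1Ineq358TreeDecaySum (treeConst sum_exp_neg_diam_le_treeConst)
open Literature.MathematicalPhysics.QuantumFieldTheory.Balaban1983to89.B2Ineq2116TreeDecayRegion (sum_exp_neg_diam_pin_le sum_exp_neg_diam_loc_le)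
open Literature.MathematicalPhysics.QuantumFieldTheory.Balaban1983to89.B4Sect5Proof (latticeConst)

/-- **Whole-torus localization sum with the PRINTED tree length.**  III p. 421: *"Proposition I.3.1 is completely obvious if we sum over
localizations …"* — in the unit-lattice currency (localization cubes of `T_η^{(k)}` labelled by the sites of `T₁^{(k)}`, tree length of the
label tuple in the distance (1.3)): `Σ_{z : Fin q → T^{(k)}} e^{−δ·d(z)} ≦ |T^{(k)}|·treeConst_q(δ)` for `δ > 0` — p14's diameter summation
`sum_exp_neg_diam_le_treeConst` fed through `d(z) ≧ diam z`.  (p19's `boxTreeLen`, positions INSIDE the cubes in η-units, is not compared here.)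
[cite: Balaban1983Higgs3, p.421; Balaban1982Higgs1, Prop. 3.1 p.620, Prop. 3.2 (3.58) p.622] -/
theorem sum_exp_neg_treeLen_le_treeConst {δ : ℝ} (hδ : 0 < δ) (q : ℕ) :
    ∑ z : Fin q → HiggsLattice.Site P k, Real.exp (-(δ * treeLen (fun i j => (HiggsLattice.Site.tdist (z i) (z j) : ℝ))))
      ≤ (Fintype.card (HiggsLattice.Site P k) : ℝ) * treeConst P.d δ q :=
  (Finset.sum_le_sum fun z _ => exp_neg_treeLen_le_exp_neg_diam hδ.le z).trans (sum_exp_neg_diam_le_treeConst hδ q)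

/-- **Pinned localization sum**: one localization held in a finite set `Λ ⊂ T^{(k)}` (coordinate `i₀`), the other `r` summed over the torus:
`Σ_{z : Fin (r+1) → T^{(k)}, z_{i₀} ∈ Λ} e^{−δ·d(z)} ≦ |Λ|·K_d(δ/r)^r` (the typer's `sum_exp_neg_diam_pin_le` through `d(z) ≧ diam z`).
[cite: Balaban1983Higgs3, p.421; Balaban1982Higgs2, (2.116) p.582] -/
theorem sum_exp_neg_treeLen_pin_le {r : ℕ} {δ : ℝ} (hδ : 0 < δ) (Λ : Finset (HiggsLattice.Site P k)) (i₀ : Fin (r + 1)) :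
    ∑ z : Fin (r + 1) → HiggsLattice.Site P k,
        (if z i₀ ∈ Λ then Real.exp (-(δ * treeLen (fun i j => (HiggsLattice.Site.tdist (z i) (z j) : ℝ)))) else 0)
      ≤ (Λ.card : ℝ) * latticeConst P.d (δ / r) ^ r := by
  refine le_trans (Finset.sum_le_sum fun z _ => ?_) (sum_exp_neg_diam_pin_le hδ Λ i₀)
  split_ifs with h
  · exact exp_neg_treeLen_le_exp_neg_diam hδ.le z
  · exact le_rfl

/-- **Localized localization sum**: at least one localization in `Λ`: `Σ_{z : Fin q → T^{(k)}, ∃ i, z_i ∈ Λ} e^{−δ·d(z)} ≦ q·|Λ|·treeConst_q(δ)`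
— the summation that turns a tree-decaying bound per localization tuple into the printed `O(·)·|region|`.
[cite: Balaban1983Higgs3, p.421; Balaban1982Higgs2, (2.116) p.582, Prop. 2.1 (2.57) p.570] -/
theorem sum_exp_neg_treeLen_loc_le {δ : ℝ} (hδ : 0 < δ) (Λ : Finset (HiggsLattice.Site P k)) (q : ℕ) :
    ∑ z : Fin q → HiggsLattice.Site P k,
        (if ∃ i, z i ∈ Λ then Real.exp (-(δ * treeLen (fun i j => (HiggsLattice.Site.tdist (z i) (z j) : ℝ)))) else 0)
      ≤ (q : ℝ) * (Λ.card : ℝ) * treeConst P.d δ q := by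
  refine le_trans (Finset.sum_le_sum fun z _ => ?_) (sum_exp_neg_diam_loc_le hδ Λ q)
  split_ifs with h
  · exact exp_neg_treeLen_le_exp_neg_diam hδ.le z
  · exact le_rfl

end LocalizationSums

end Literature.MathematicalPhysics.QuantumFieldTheory.Balaban1983to89.B1Ineq358TreeLength
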